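import Literature.MathematicalPhysics.QuantumManyBody.DiluteBoseGasTrialLambda
import Literature.MathematicalPhysics.QuantumManyBody.DiluteBoseGasScalarResummation
import Literature.MathematicalPhysics.QuantumManyBody.DiluteBoseGasCubicSector
import HarnessLib

/-!
# The BCS trial state: the main terms resummed (quasi-free and cubic-sector identities applied)

Topic `Literature/MathematicalPhysics/QuantumManyBody`, namespace `BoseGas.BCSTrial`; theorem-only, for
the provefact `Literature.MathematicalPhysics.QuantumManyBody.BoseGas.BastiCenatiempoSchlein2021_upperBound`.

`kin_add_main_eq`: the main part `KIN + MAIN/(2L³)` of `trialEnergy_le` equals the right sides of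
`ScalarResummation.quasiFree_identity` (quasi-free sector, with `N₀ + S = N` and the exact Galerkin
scattering equation) and of `Fock.cubicSector_identity` (cubic sector, Lemma 5.1 of
[BastiCenatiempoSchlein2021]) for the concrete data: `(N/2)ρ̃ĝ₀ +` the low-momentum Bogoliubov terms
`+` the linear term `- (ρ̃/2)∑_{P_L}ĝη`, minus the part `X` cancelled by the cubic term `X_c`, plus
the explicit remainders.

## References

* [BastiCenatiempoSchlein2021] G. Basti, S. Cenatiempo, B. Schlein, Forum Math. Sigma 9 (2021) e74,
  arXiv:2101.06222: Props. 3.1–3.2, Lemma 5.1, §5 (first page).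
-/

noncomputable section

namespace Literature.MathematicalPhysics.QuantumManyBody.BoseGas

open MeasureTheory Complex Finset MvPolynomial
open scoped ENNReal NNReal BigOperators ComplexConjugate

namespace BCSTrial

variable {v : ℝ → ℝ≥0∞} {ρ : ℝ}

/-- `N₀ + S = N`. [cite: BastiCenatiempoSchlein2021, (eq:fixN0)] -/
theorem condensate_add_depletion (v : ℝ → ℝ≥0∞) (ρ : ℝ) : condensate v ρ + depletion v ρ = particleNumber ρ := by
  unfold condensate; ring

/-- **The exact scattering equation in the form of the quasi-free identity**:
`ε_pη_p + (N/L³)/2·W(e p) + (2L³)⁻¹∑_q W(e q - e p)η_q = 0` for `p ≠ z`. [cite: BastiCenatiempoSchlein2021, (2.5), (eq:scatt)] -/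
theorem scattering_equation (hv : Measurable v) (hint : (∫⁻ x : Space, v ‖x‖) ≠ ⊤) (hρ : 0 < ρ)
    {p : ModeBox (boxSize ρ)} (hp : p ≠ z _) :
    eps ρ p * eta v ρ p + particleNumber ρ / boxSide ρ ^ 3 / 2 * W v ρ (e _ p) +
      (2 * boxSide ρ ^ 3)⁻¹ * ∑ q, W v ρ (e _ q - e _ p) * eta v ρ q = 0 := by
  have hL := boxSide_pos hρ
  have hN := particleNumber_pos hρ
  have hEL := (galerkinMin_spec hv hint hρ).2.2 ⟨p, hp⟩
  -- `∑` over the box = over the band (`c_z = 0`)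
  have hsum : ∑ q, W v ρ (e _ q - e _ p) * eta v ρ q =
      -(particleNumber ρ) * ∑ q : Band ρ, W v ρ (e _ p - e _ q.1) * galerkinMin v ρ q := by
    rw [sum_modeBox_eq_add_sum_band (fun q => W v ρ (e _ q - e _ p) * eta v ρ q), eta_z, mul_zero, zero_add,
      Finset.mul_sum]
    refine Finset.sum_congr rfl fun q _ => ?_
    have hc : eta v ρ q.1 = -(particleNumber ρ) * galerkinMin v ρ q := by
      unfold eta cExt; rw [dif_neg q.2]
    rw [hc, ← W_neg v ρ (e _ q.1 - e _ p), neg_sub]; ring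
  have hη : eta v ρ p = -(particleNumber ρ) * galerkinMin v ρ ⟨p, hp⟩ := by
    unfold eta cExt; rw [dif_neg hp]
  rw [hsum, hη]
  have h3 : boxSide ρ ^ 3 ≠ 0 := by positivity
  field_simp
  linear_combination (-(particleNumber ρ)) * hEL

set_option maxHeartbeats 2000000 in
/-- **`KIN + MAIN/(2L³)` resummed.** [cite: BastiCenatiempoSchlein2021, Props. 3.1–3.2, Lemma 5.1] -/
theorem kin_add_main_eq (hv : Measurable v) (hint : (∫⁻ x : Space, v ‖x‖) ≠ ⊤) (hρ : 0 < ρ) :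
    let GM := Fock.bogGamma (neg (boxSize ρ)) (halfSpace (boxSize ρ)) (tAmp v ρ)
    let SG := Fock.bogSigma (neg (boxSize ρ)) (halfSpace (boxSize ρ)) (tAmp v ρ)
    let Wc : Momentum → ℂ := fun k => ((W v ρ k : ℝ) : ℂ);
    ((∑ p, eps ρ p * SG p ^ 2) +
        ∑ τ : Fock.Triple (e (boxSize ρ)) (hardSet ρ) (softSet ρ), (eps ρ τ.u * (GM τ.u ^ 2 + SG τ.u ^ 2) +
          eps ρ τ.a * (GM τ.a ^ 2 + SG τ.a ^ 2) +
          eps ρ τ.b * (GM τ.b ^ 2 + SG τ.b ^ 2)) * ‖kappa v ρ τ‖ ^ 2) +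
      (        (∑ τ' : Fock.Triple (e (boxSize ρ)) (hardSet ρ) (softSet ρ), ∑ τ : Fock.Triple (e (boxSize ρ)) (hardSet ρ) (softSet ρ), (if τ.b = τ'.b then
          kappa v ρ τ' * conj (kappa v ρ τ) * (Fock.hardKernel (e (boxSize ρ)) Wc GM (hardSet ρ) τ.u τ.a τ'.u τ'.a +
            Fock.hardKernel (e (boxSize ρ)) Wc GM (hardSet ρ) τ.u τ.a τ'.a τ'.u + Fock.hardKernel (e (boxSize ρ)) Wc GM (hardSet ρ) τ.a τ.u τ'.u τ'.a +
            Fock.hardKernel (e (boxSize ρ)) Wc GM (hardSet ρ) τ.a τ.u τ'.a τ'.u) else 0)).re +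
        Real.sqrt (condensate v ρ) * ((∑ τ : Fock.Triple (e (boxSize ρ)) (hardSet ρ) (softSet ρ), Fock.arrSum (Fock.cubicCoeff (e (boxSize ρ)) Wc GM SG) τ * conj (kappa v ρ τ)).re) +
        (((condensate v ρ : ℝ) : ℂ) ^ 2 * Wc 0 +
          ((condensate v ρ : ℝ) : ℂ) * (∑ p, ((2 * Wc 0 + Wc (e (boxSize ρ) p) + Wc (-e (boxSize ρ) p)) * ((SG p ^ 2 : ℝ) : ℂ) +
            (Wc (e (boxSize ρ) p) + Wc (-e (boxSize ρ) p)) * ((GM p * SG p : ℝ) : ℂ))) +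
          (∑ p, ∑ p', Wc (e (boxSize ρ) p' - e (boxSize ρ) p) *
            (((GM p * SG p * (GM p' * SG p')) : ℝ) : ℂ)) +
          ((∑ p, ∑ q, Wc (e (boxSize ρ) q - e (boxSize ρ) p) * (((SG p ^ 2 * SG q ^ 2 : ℝ)) : ℂ)) +
            Wc 0 * ((((∑ p, SG p ^ 2) ^ 2 : ℝ)) : ℂ))).re) / (2 * boxSide ρ ^ 3) =
    ( -- quasi-free sector
      -- main terms
      particleNumber ρ / 2 * (particleNumber ρ / boxSide ρ ^ 3) *
          (W v ρ (e (boxSize ρ) (z (boxSize ρ))) + (particleNumber ρ)⁻¹ * ∑ q, W v ρ (e (boxSize ρ) q - e (boxSize ρ) (z (boxSize ρ))) * eta v ρ q) +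
        (∑ l ∈ lowSet ρ, (eps ρ l * SG l ^ 2 + (SG l ^ 2 + (GM l * SG l)) * (particleNumber ρ / boxSide ρ ^ 3 *
          (W v ρ (e (boxSize ρ) l) + (particleNumber ρ)⁻¹ * ∑ q, W v ρ (e (boxSize ρ) q - e (boxSize ρ) l) * eta v ρ q)))) -
        particleNumber ρ / boxSide ρ ^ 3 / 2 * ∑ l ∈ lowSet ρ, (W v ρ (e (boxSize ρ) l) + (particleNumber ρ)⁻¹ * ∑ q, W v ρ (e (boxSize ρ) q - e (boxSize ρ) l) * eta v ρ q) * eta v ρ l -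
      -- the part cancelled by the cubic vector
      (depletion v ρ / boxSide ρ ^ 3 * ∑ p ∈ (Finset.univ \ insert (z (boxSize ρ)) (lowSet ρ)), W v ρ (e (boxSize ρ) p) * eta v ρ p +
        (boxSide ρ ^ 3)⁻¹ * ∑ l ∈ lowSet ρ, SG l ^ 2 * ∑ r ∈ (Finset.univ \ insert (z (boxSize ρ)) (lowSet ρ)), W v ρ (e (boxSize ρ) r - e (boxSize ρ) l) * eta v ρ r) +
      -- remainder
      ((∑ p ∈ (Finset.univ \ insert (z (boxSize ρ)) (lowSet ρ)), eps ρ p * (SG p ^ 2 - eta v ρ p ^ 2)) +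
        condensate v ρ / boxSide ρ ^ 3 * ∑ p ∈ (Finset.univ \ insert (z (boxSize ρ)) (lowSet ρ)), W v ρ (e (boxSize ρ) p) * (eta v ρ p ^ 2 + (SG p ^ 2 - eta v ρ p ^ 2) + ((GM p * SG p) - eta v ρ p)) +
        (2 * boxSide ρ ^ 3)⁻¹ * ∑ p ∈ lowSet ρ, ∑ q ∈ lowSet ρ, W v ρ (e (boxSize ρ) q - e (boxSize ρ) p) * ((GM p * SG p) * (GM q * SG q)) +
        (boxSide ρ ^ 3)⁻¹ * ∑ l ∈ lowSet ρ, (GM l * SG l) * ∑ p ∈ (Finset.univ \ insert (z (boxSize ρ)) (lowSet ρ)), W v ρ (e (boxSize ρ) p - e (boxSize ρ) l) * ((GM p * SG p) - eta v ρ p) +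
        (2 * boxSide ρ ^ 3)⁻¹ * ∑ p ∈ (Finset.univ \ insert (z (boxSize ρ)) (lowSet ρ)), ∑ q ∈ (Finset.univ \ insert (z (boxSize ρ)) (lowSet ρ)),
          W v ρ (e (boxSize ρ) q - e (boxSize ρ) p) * (((GM p * SG p) - eta v ρ p) * eta v ρ q + eta v ρ p * ((GM q * SG q) - eta v ρ q) + ((GM p * SG p) - eta v ρ p) * ((GM q * SG q) - eta v ρ q)) +
        (∑ p, ∑ q, W v ρ (e (boxSize ρ) q - e (boxSize ρ) p) * (SG p ^ 2 * SG q ^ 2)) / (2 * boxSide ρ ^ 3) -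
        depletion v ρ / boxSide ρ ^ 3 * ∑ l ∈ lowSet ρ, W v ρ (e (boxSize ρ) l) * (SG l ^ 2 + (GM l * SG l)) -
        (boxSide ρ ^ 3)⁻¹ * ∑ l ∈ lowSet ρ, (SG l ^ 2 + (GM l * SG l)) * ∑ q ∈ lowSet ρ, W v ρ (e (boxSize ρ) q - e (boxSize ρ) l) * eta v ρ q +
        (2 * boxSide ρ ^ 3)⁻¹ * ∑ l ∈ lowSet ρ, eta v ρ l * ∑ q ∈ lowSet ρ, W v ρ (e (boxSize ρ) q - e (boxSize ρ) l) * eta v ρ q) ) +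
    ( -- cubic sector
      -- `X_c`: the term of Prop. 3.2
      (boxSide ρ ^ 3)⁻¹ * ∑ τ : Fock.Triple (e (boxSize ρ)) (hardSet ρ) (softSet ρ), SG τ.b ^ 2 * (W v ρ (e (boxSize ρ) τ.u) + W v ρ (e (boxSize ρ) τ.a)) * (eta v ρ τ.u + eta v ρ τ.a) +
      -- the scattering-equation brackets at the two hard modes (zero by the exact equation)
      (∑ τ : Fock.Triple (e (boxSize ρ)) (hardSet ρ) (softSet ρ), (particleNumber ρ)⁻¹ * SG τ.b ^ 2 * (eta v ρ τ.u + eta v ρ τ.a) *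
        ((2 * eps ρ τ.u * eta v ρ τ.u + particleNumber ρ / boxSide ρ ^ 3 * W v ρ (e (boxSize ρ) τ.u) + (boxSide ρ ^ 3)⁻¹ * ∑ q, W v ρ (e (boxSize ρ) τ.u - e (boxSize ρ) q) * eta v ρ q) +
          (2 * eps ρ τ.a * eta v ρ τ.a + particleNumber ρ / boxSide ρ ^ 3 * W v ρ (e (boxSize ρ) τ.a) + (boxSide ρ ^ 3)⁻¹ * ∑ q, W v ρ (e (boxSize ρ) τ.a - e (boxSize ρ) q) * eta v ρ q))) +
      -- `R₁`
      (∑ τ : Fock.Triple (e (boxSize ρ)) (hardSet ρ) (softSet ρ), (particleNumber ρ)⁻¹ * SG τ.b ^ 2 * (eta v ρ τ.u + eta v ρ τ.a) *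
        (2 * (particleNumber ρ / boxSide ρ ^ 3) * (W v ρ (e (boxSize ρ) τ.u) + W v ρ (e (boxSize ρ) τ.a)) * (Real.sqrt (condensate v ρ) * (GM τ.u * GM τ.a) / Real.sqrt (particleNumber ρ) - 1))) +
      -- `R₂`
      (∑ τ : Fock.Triple (e (boxSize ρ)) (hardSet ρ) (softSet ρ), (particleNumber ρ)⁻¹ * SG τ.b ^ 2 * (eta v ρ τ.u + eta v ρ τ.a) *
          ((eps ρ τ.a + eps ρ τ.b - eps ρ τ.u) * eta v ρ τ.u + (eps ρ τ.u + eps ρ τ.b - eps ρ τ.a) * eta v ρ τ.a) +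
        ∑ τ : Fock.Triple (e (boxSize ρ)) (hardSet ρ) (softSet ρ), (particleNumber ρ)⁻¹ * (eta v ρ τ.u + eta v ρ τ.a) ^ 2 * SG τ.b ^ 2 *
          (eps ρ τ.u * (GM τ.u ^ 2 + SG τ.u ^ 2 - 1) + eps ρ τ.a * (GM τ.a ^ 2 + SG τ.a ^ 2 - 1) +
            eps ρ τ.b * (GM τ.b ^ 2 + SG τ.b ^ 2 - 1))) +
      -- `R₃`
      ((∑ τ' : Fock.Triple (e (boxSize ρ)) (hardSet ρ) (softSet ρ), ∑ τ : Fock.Triple (e (boxSize ρ)) (hardSet ρ) (softSet ρ), (if τ.b = τ'.b then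
          kappa v ρ τ' * conj (kappa v ρ τ) * (Fock.hardKernel (e (boxSize ρ)) Wc GM (hardSet ρ) τ.u τ.a τ'.u τ'.a +
            Fock.hardKernel (e (boxSize ρ)) Wc GM (hardSet ρ) τ.u τ.a τ'.a τ'.u +
            Fock.hardKernel (e (boxSize ρ)) Wc GM (hardSet ρ) τ.a τ.u τ'.u τ'.a +
            Fock.hardKernel (e (boxSize ρ)) Wc GM (hardSet ρ) τ.a τ.u τ'.a τ'.u) else 0)).re / (2 * boxSide ρ ^ 3) -
        ∑ τ : Fock.Triple (e (boxSize ρ)) (hardSet ρ) (softSet ρ), (particleNumber ρ)⁻¹ * SG τ.b ^ 2 * (eta v ρ τ.u + eta v ρ τ.a) *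
          ((boxSide ρ ^ 3)⁻¹ * ((∑ q, W v ρ (e (boxSize ρ) τ.u - e (boxSize ρ) q) * eta v ρ q) + ∑ q, W v ρ (e (boxSize ρ) τ.a - e (boxSize ρ) q) * eta v ρ q))) +
      -- `R₄`
      Real.sqrt (condensate v ρ) * (∑ τ : Fock.Triple (e (boxSize ρ)) (hardSet ρ) (softSet ρ),
        2 * ((W v ρ (e (boxSize ρ) τ.b) + W v ρ (e (boxSize ρ) τ.a)) * (GM τ.u * SG τ.a * SG τ.b) +
            (W v ρ (e (boxSize ρ) τ.b) + W v ρ (e (boxSize ρ) τ.u)) * (GM τ.a * SG τ.u * SG τ.b) +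
            (W v ρ (e (boxSize ρ) τ.a) + W v ρ (e (boxSize ρ) τ.b)) * (GM τ.u * SG τ.b * SG τ.a) +
            (W v ρ (e (boxSize ρ) τ.u) + W v ρ (e (boxSize ρ) τ.b)) * (GM τ.u * GM τ.b * SG τ.a) +
            (W v ρ (e (boxSize ρ) τ.u) + W v ρ (e (boxSize ρ) τ.b)) * (GM τ.a * SG τ.b * SG τ.u) +
            (W v ρ (e (boxSize ρ) τ.a) + W v ρ (e (boxSize ρ) τ.b)) * (GM τ.a * GM τ.b * SG τ.u) +
            (W v ρ (e (boxSize ρ) τ.a) + W v ρ (e (boxSize ρ) τ.u)) * (GM τ.b * SG τ.u * SG τ.a) +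
            (W v ρ (e (boxSize ρ) τ.b) + W v ρ (e (boxSize ρ) τ.u)) * (GM τ.b * GM τ.u * SG τ.a) +
            (W v ρ (e (boxSize ρ) τ.u) + W v ρ (e (boxSize ρ) τ.a)) * (GM τ.b * SG τ.a * SG τ.u) +
            (W v ρ (e (boxSize ρ) τ.b) + W v ρ (e (boxSize ρ) τ.a)) * (GM τ.b * GM τ.a * SG τ.u)) *
          ((eta v ρ τ.u + eta v ρ τ.a) * SG τ.b / Real.sqrt (particleNumber ρ))) / (2 * boxSide ρ ^ 3) ) := by
  intro GM SG Wc
  classical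
  have hL := boxSide_pos hρ
  have hN := particleNumber_pos hρ
  have hP : ∀ q ∈ halfSpace (boxSize ρ), neg _ q ∉ halfSpace _ := fun q hq => neg_not_mem_halfSpace hq
  -- (1) quasi-free identity
  have hqf := ScalarResummation.quasiFree_identity (ι := ModeBox (boxSize ρ)) (z := z _) (PL := lowSet ρ)
    (ε := eps ρ) (W := fun p => W v ρ (e _ p)) (η := eta v ρ) (sg2 := fun p => SG p ^ 2) (gs := fun p => GM p * SG p)
    (Wd := fun p q => W v ρ (e _ q - e _ p)) (N₀ := condensate v ρ) (L := boxSide ρ)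
    z_not_mem_lowSet hL (by rw [show (∑ p, SG p ^ 2) = depletion v ρ from rfl, condensate_add_depletion]; exact hN)
    (fun p q => by show W v ρ (e _ q - e _ p) = W v ρ (e _ p - e _ q); rw [← W_neg, neg_sub])
    (fun q => by show W v ρ (e _ q - e _ (z _)) = W v ρ (e _ q); rw [e_z, sub_zero])
    (eta_z v ρ) (by show SG (z _) ^ 2 = 0; rw [show SG (z _) = 0 from Fock.bogSigma_z hP (neg_z _)]; ring)
    (by show GM (z _) * SG (z _) = 0; rw [show SG (z _) = 0 from Fock.bogSigma_z hP (neg_z _)]; ring)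
    (fun p hp => by
      have h := scattering_equation hv hint hρ hp
      rw [show (∑ q, SG q ^ 2) = depletion v ρ from rfl, condensate_add_depletion]
      exact h)
  rw [show (∑ p, SG p ^ 2) = depletion v ρ from rfl, condensate_add_depletion] at hqf
  -- (2) cubic-sector identity
  have hcs := Fock.cubicSector_identity (e := e (boxSize ρ)) (PH := hardSet ρ) (PS := softSet ρ) (W v ρ) (W_neg v ρ)
    GM SG (eta v ρ) (eps ρ) (N := particleNumber ρ) (N₀ := condensate v ρ) (L := boxSide ρ) hN hL (kappa v ρ) (fun τ => rfl)
  -- (3) the constant of the quartic form is the quasi-free numerator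
  have hconst : (        (∑ τ' : Fock.Triple (e (boxSize ρ)) (hardSet ρ) (softSet ρ), ∑ τ : Fock.Triple (e (boxSize ρ)) (hardSet ρ) (softSet ρ), (if τ.b = τ'.b then
          kappa v ρ τ' * conj (kappa v ρ τ) * (Fock.hardKernel (e (boxSize ρ)) Wc GM (hardSet ρ) τ.u τ.a τ'.u τ'.a +
            Fock.hardKernel (e (boxSize ρ)) Wc GM (hardSet ρ) τ.u τ.a τ'.a τ'.u + Fock.hardKernel (e (boxSize ρ)) Wc GM (hardSet ρ) τ.a τ.u τ'.u τ'.a +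
            Fock.hardKernel (e (boxSize ρ)) Wc GM (hardSet ρ) τ.a τ.u τ'.a τ'.u) else 0)).re +
        Real.sqrt (condensate v ρ) * ((∑ τ : Fock.Triple (e (boxSize ρ)) (hardSet ρ) (softSet ρ), Fock.arrSum (Fock.cubicCoeff (e (boxSize ρ)) Wc GM SG) τ * conj (kappa v ρ τ)).re) +
        (((condensate v ρ : ℝ) : ℂ) ^ 2 * Wc 0 +
          ((condensate v ρ : ℝ) : ℂ) * (∑ p, ((2 * Wc 0 + Wc (e (boxSize ρ) p) + Wc (-e (boxSize ρ) p)) * ((SG p ^ 2 : ℝ) : ℂ) +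
            (Wc (e (boxSize ρ) p) + Wc (-e (boxSize ρ) p)) * ((GM p * SG p : ℝ) : ℂ))) +
          (∑ p, ∑ p', Wc (e (boxSize ρ) p' - e (boxSize ρ) p) *
            (((GM p * SG p * (GM p' * SG p')) : ℝ) : ℂ)) +
          ((∑ p, ∑ q, Wc (e (boxSize ρ) q - e (boxSize ρ) p) * (((SG p ^ 2 * SG q ^ 2 : ℝ)) : ℂ)) +
            Wc 0 * ((((∑ p, SG p ^ 2) ^ 2 : ℝ)) : ℂ))).re) =
      ((∑ τ' : Fock.Triple (e (boxSize ρ)) (hardSet ρ) (softSet ρ), ∑ τ : Fock.Triple (e (boxSize ρ)) (hardSet ρ) (softSet ρ), (if τ.b = τ'.b then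
          kappa v ρ τ' * conj (kappa v ρ τ) * (Fock.hardKernel (e (boxSize ρ)) Wc GM (hardSet ρ) τ.u τ.a τ'.u τ'.a +
            Fock.hardKernel (e (boxSize ρ)) Wc GM (hardSet ρ) τ.u τ.a τ'.a τ'.u + Fock.hardKernel (e (boxSize ρ)) Wc GM (hardSet ρ) τ.a τ.u τ'.u τ'.a +
            Fock.hardKernel (e (boxSize ρ)) Wc GM (hardSet ρ) τ.a τ.u τ'.a τ'.u) else 0)).re +
        Real.sqrt (condensate v ρ) * (∑ τ : Fock.Triple (e (boxSize ρ)) (hardSet ρ) (softSet ρ), Fock.arrSum (Fock.cubicCoeff (e (boxSize ρ)) Wc GM SG) τ * conj (kappa v ρ τ)).re) +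
      (W v ρ (e (boxSize ρ) (z (boxSize ρ)) - e (boxSize ρ) (z (boxSize ρ))) * particleNumber ρ ^ 2 + 2 * condensate v ρ * ∑ p, W v ρ (e (boxSize ρ) p) * (SG p ^ 2 + GM p * SG p) +
        ∑ p, ∑ q, W v ρ (e (boxSize ρ) q - e (boxSize ρ) p) * ((GM p * SG p) * (GM q * SG q) + SG p ^ 2 * SG q ^ 2)) := by
    have hre : (((condensate v ρ : ℝ) : ℂ) ^ 2 * Wc 0 +
          ((condensate v ρ : ℝ) : ℂ) * (∑ p, ((2 * Wc 0 + Wc (e (boxSize ρ) p) + Wc (-e (boxSize ρ) p)) * ((SG p ^ 2 : ℝ) : ℂ) +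
            (Wc (e (boxSize ρ) p) + Wc (-e (boxSize ρ) p)) * ((GM p * SG p : ℝ) : ℂ))) +
          (∑ p, ∑ p', Wc (e (boxSize ρ) p' - e (boxSize ρ) p) *
            (((GM p * SG p * (GM p' * SG p')) : ℝ) : ℂ)) +
          ((∑ p, ∑ q, Wc (e (boxSize ρ) q - e (boxSize ρ) p) * (((SG p ^ 2 * SG q ^ 2 : ℝ)) : ℂ)) +
            Wc 0 * ((((∑ p, SG p ^ 2) ^ 2 : ℝ)) : ℂ))) =
        (((condensate v ρ ^ 2 * W v ρ 0 + condensate v ρ * (∑ p, ((2 * W v ρ 0 + W v ρ (e (boxSize ρ) p) + W v ρ (-e (boxSize ρ) p)) * SG p ^ 2 +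
            (W v ρ (e (boxSize ρ) p) + W v ρ (-e (boxSize ρ) p)) * (GM p * SG p))) +
          (∑ p, ∑ p', W v ρ (e (boxSize ρ) p' - e (boxSize ρ) p) * (GM p * SG p * (GM p' * SG p'))) +
          ((∑ p, ∑ q, W v ρ (e (boxSize ρ) q - e (boxSize ρ) p) * (SG p ^ 2 * SG q ^ 2)) + W v ρ 0 * (∑ p, SG p ^ 2) ^ 2) : ℝ)) : ℂ) := by
      push_cast
      rfl
    rw [hre, Complex.ofReal_re]
    simp only [W_neg, e_z, sub_self]
    rw [show (∑ p, SG p ^ 2) = depletion v ρ from rfl]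
    have hN2 : particleNumber ρ = condensate v ρ + depletion v ρ := (condensate_add_depletion v ρ).symm
    rw [hN2]
    have h1 : ∑ p, ((2 * W v ρ 0 + W v ρ (e (boxSize ρ) p) + W v ρ (e (boxSize ρ) p)) * SG p ^ 2 + (W v ρ (e (boxSize ρ) p) + W v ρ (e (boxSize ρ) p)) * (GM p * SG p)) =
        2 * W v ρ 0 * depletion v ρ + 2 * ∑ p, W v ρ (e (boxSize ρ) p) * (SG p ^ 2 + GM p * SG p) := by
      rw [show depletion v ρ = ∑ p, SG p ^ 2 from rfl, Finset.mul_sum, Finset.mul_sum, ← Finset.sum_add_distrib]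
      exact Finset.sum_congr rfl fun p _ => by ring
    have h2 : ∑ p, ∑ q, W v ρ (e (boxSize ρ) q - e (boxSize ρ) p) * ((GM p * SG p) * (GM q * SG q) + SG p ^ 2 * SG q ^ 2) =
        (∑ p, ∑ p', W v ρ (e (boxSize ρ) p' - e (boxSize ρ) p) * (GM p * SG p * (GM p' * SG p'))) +
          ∑ p, ∑ q, W v ρ (e (boxSize ρ) q - e (boxSize ρ) p) * (SG p ^ 2 * SG q ^ 2) := by
      rw [← Finset.sum_add_distrib]
      refine Finset.sum_congr rfl fun p _ => ?_
      rw [← Finset.sum_add_distrib]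
      exact Finset.sum_congr rfl fun q _ => by ring
    rw [h1, h2]
    ring
  rw [hconst]
  rw [← hqf, ← hcs]
  ring
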